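import Summits.SmoothPoincare4.SmoothPoincare4.Theses.ZeroSurgeryExotic
import Literature.Topology.FourManifolds.LeeRasmussen
import Literature.Topology.FourManifolds.KirbyMoves
import Literature.Topology.FourManifolds.SliceGenus

/-!
# Sketch — crux-ideate stmt-SmoothPoincare4-0366 (ZseCruxRasmussen), ideator 3, round 1

First lemmas of the three idea cards, stated over existing declarations.  Nothing here is a
route item; `CruxBody` is the ledger signature of item stmt-SmoothPoincare4-0366 verbatim (the
route file carries it only as a TODO comment because it does not import `LeeRasmussen`).
-/

noncomputable section

open scoped Manifold ContDiff
open Literature.Topology.FourManifolds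

namespace Summit.SmoothPoincare4.SmoothPoincare4.Cruxes.ZseCruxRasmussen.Sketch3

/-- The crux, ledger signature of stmt-SmoothPoincare4-0366 verbatim. -/
def CruxBody : Prop :=
  ∃ (K K' : Knot) (Y : Type) (_ : TopologicalSpace Y)
    (_ : ChartedSpace (EuclideanSpace ℝ (Fin 3)) Y) (s : ℤ),
    IsIntegralSurgery (𝓡 3) Y K 0 ∧ IsIntegralSurgery (𝓡 3) Y K' 0 ∧
      K.IsSmoothlySlice ∧ K'.HasRasmussenInvariant s ∧ s ≠ 0

/-- `K` and `K'` are **0-friends**: some 3-manifold is `0`-surgery on both. -/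
def ZeroFriends (K K' : Knot) : Prop :=
  ∃ (Y : Type) (_ : TopologicalSpace Y) (_ : ChartedSpace (EuclideanSpace ℝ (Fin 3)) Y),
    IsIntegralSurgery (𝓡 3) Y K 0 ∧ IsIntegralSurgery (𝓡 3) Y K' 0

/-! ## Card 1, remark (B) — twist families and the single jump -/

/-- **Twist-family supply** (output of the band-axis construction: a pattern-level 0-surgery
correspondence twisted `t` times along the axis): a `ℤ`-indexed family of 0-friend pairs whose
first members are all ribbon. -/
def TwistFamilySupply (KB KG : ℤ → Knot) : Prop :=
  (∀ t, (KB t).IsRibbon) ∧ ∀ t, ZeroFriends (KB t) (KG t)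

/-- **Single-jump behaviour** of `s/2` along a twist family of a wrapping-number-two,
winding-number-zero pattern (Lewark–Zibrowius 2024, Prop. 1.2, for the slice-torus invariant
`s₀/2`), relational form: either `s` is constant along the family, or there are a jump point
`θ` and a value `a` with `s = a + 2` strictly below `θ` and `s = a` from `θ` on. -/
def SingleJumpOrConstant (KG : ℤ → Knot) : Prop :=
  (∃ s, ∀ t, (KG t).HasRasmussenInvariant s) ∨
    ∃ (θ a : ℤ), ∀ t, (KG t).HasRasmussenInvariant (if t < θ then a + 2 else a)

/-- The family **has a Rasmussen jump**: two members with different `s`. -/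
def HasJump (KG : ℤ → Knot) : Prop :=
  ∃ t t' s s', (KG t).HasRasmussenInvariant s ∧ (KG t').HasRasmussenInvariant s' ∧ s ≠ s'

/-- **First lemma of card 1.** A twist-family supply with a Rasmussen jump proves the crux:
one of the two differing values is nonzero, and its index gives the witness pair. -/
theorem cruxBody_of_twistFamily (KB KG : ℤ → Knot) (hsup : TwistFamilySupply KB KG)
    (hj : HasJump KG) : CruxBody := by
  obtain ⟨hrib, hfr⟩ := hsup
  obtain ⟨t, t', s, s', hs, hs', hne⟩ := hj
  by_cases h0 : s = 0
  · subst h0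
    have hs'0 : s' ≠ 0 := fun h => hne h.symm
    obtain ⟨Y, _, _, hK, hK'⟩ := hfr t'
    exact ⟨KB t', KG t', Y, _, _, s', hK, hK', (hrib t').isSmoothlySlice, hs', hs'0⟩
  · obtain ⟨Y, _, _, hK, hK'⟩ := hfr t
    exact ⟨KB t, KG t, Y, _, _, s, hK, hK', (hrib t).isSmoothlySlice, hs, h0⟩

/-- With the single-jump structure, a jump is the same as a finite jump point with the upper
value `a + 2 ≠ a`; in the sign-pinned case `a = 0` (forced by Nakamura's Lemma 3.5 when the
dual meridian is `(U, r)`, `r ≥ 1`) the members below the jump point have `s = 2`. -/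
theorem hasJump_of_jumpPoint (KG : ℤ → Knot) (θ a : ℤ)
    (h : ∀ t, (KG t).HasRasmussenInvariant (if t < θ then a + 2 else a)) : HasJump KG := by
  refine ⟨θ - 1, θ, a + 2, a, ?_, ?_, by omega⟩
  · simpa using h (θ - 1)
  · simpa using h θ

/-! ## Card 1 (revised) — Lewark–Zibrowius transport at the R-companion -/

/-- **LZ transport** (Lewark–Zibrowius 2024 main theorem for `c = 2`; their Conjecture 1.13 for
`c = 0`, which is the tree's `s`), relational form for one special RBG link: `KG r` is the
G-knot of the link with `R = U` and framing `r`, `KGJ r` the G-knot with the companion `J` tied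
into `R` (a wrapping-two, winding-zero satellite of `J`), `θ = ±θ(J)`: the `s`-invariant is
transported along the framing shift `r ↦ r - θ`. -/
def LZTransportAt (KG KGJ : ℤ → Knot) (θ : ℤ) : Prop :=
  ∀ r s, (KG (r - θ)).HasRasmussenInvariant s → (KGJ r).HasRasmussenInvariant s

/-- **First lemma of card 1.** Transport + one COMPUTED value of the `R = U` family (MP's
`s(K_i') = -2` at framing `rᵢ`) + a ribbon B-partner at the shifted framing `rᵢ + θ` prove the
crux: the `s`-witness is inherited by theorem, only ribbonness is searched. -/
theorem cruxBody_of_transport (KG KGJ KBJ : ℤ → Knot) (θ rᵢ : ℤ)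
    (hT : LZTransportAt KG KGJ θ) (hMP : (KG rᵢ).HasRasmussenInvariant (-2))
    (hrib : (KBJ (rᵢ + θ)).IsRibbon) (hfr : ZeroFriends (KBJ (rᵢ + θ)) (KGJ (rᵢ + θ))) :
    CruxBody := by
  obtain ⟨Y, _, _, h1, h2⟩ := hfr
  refine ⟨KBJ (rᵢ + θ), KGJ (rᵢ + θ), Y, _, _, -2, h1, h2, hrib.isSmoothlySlice, ?_, by norm_num⟩
  exact hT (rᵢ + θ) (-2) (by simpa using hMP)

/-- Any ribbon 0-friend of a knot with nonzero `s` proves the crux (the shape shared by all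
three cards). -/
theorem cruxBody_of_ribbonPartner {K K' : Knot} {s : ℤ} (hK : K.IsRibbon)
    (hfr : ZeroFriends K K') (hs : K'.HasRasmussenInvariant s) (hs0 : s ≠ 0) : CruxBody := by
  obtain ⟨Y, _, _, h1, h2⟩ := hfr
  exact ⟨K, K', Y, _, _, s, h1, h2, hK.isSmoothlySlice, hs, hs0⟩

/-! ## Card 2 — genus-one witness-first search -/

/-- **Gabai's rigidity** (Foliations III, 1987, Cor. 8.2/8.3): 0-friends have the same Seifert
genus (named-fact form over the tree's `Knot.genus`). -/
def genus_eq_of_zeroFriends : Prop :=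
  ∀ {K K' : Knot}, ZeroFriends K K' → K.genus = K'.genus

/-- The **witness class** the crux forces on `K'` (card 2): nonzero `s`, genus one — the
twisted Whitehead doubles in the Hedden–Ording / Lewark–Zibrowius window are the examples with
theorem-certified `s ≠ 0 = τ`. -/
def InGenusOneWitnessClass (K' : Knot) : Prop :=
  K'.genus = 1 ∧ ∃ s, K'.HasRasmussenInvariant s ∧ s ≠ 0

/-- **First lemma of card 2** (search inversion + genus rigidity): a genus-one witness `K'`
together with a RIBBON 0-friend — which by Gabai must itself have genus one — proves the crux;
conversely (given Gabai) every witness pair with `K'` of genus one has `K` of genus one, so the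
partner search runs over genus-one ribbon knots only. -/
theorem cruxBody_of_genusOneWitness {K K' : Knot} (hK' : InGenusOneWitnessClass K')
    (hK : K.IsRibbon) (hfr : ZeroFriends K K') : CruxBody := by
  obtain ⟨-, s, hs, hs0⟩ := hK'
  obtain ⟨Y, _, _, h1, h2⟩ := hfr
  exact ⟨K, K', Y, _, _, s, h1, h2, hK.isSmoothlySlice, hs, hs0⟩

theorem partner_genus_one (hG : genus_eq_of_zeroFriends) {K K' : Knot}
    (hK' : InGenusOneWitnessClass K') (hfr : ZeroFriends K K') : K.genus = 1 :=
  (hG hfr).trans hK'.1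

/-! ## Card 3 — R-link refill (transfer) -/

/-- `L` is an **R-link**: its (framed) surgery is also the surgery on a `0`-framed split
unlink with the same number of components, i.e. `S³_L ≅ #ⁿ(S¹ × S²)`. -/
def IsRLink {n : ℕ} (L : FramedLink (Fin n)) : Prop :=
  ∃ (Y : Type) (_ : TopologicalSpace Y) (_ : ChartedSpace (EuclideanSpace ℝ (Fin 3)) Y),
    L.IsSurgery (𝓡 3) Y ∧ ∃ U : FramedLink (Fin n), U.IsZeroFramedUnlink ∧ U.IsSurgery (𝓡 3) Y

/-- **First lemma of card 3** (FGMW half, named-fact form): every component of an R-link is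
slice in a homotopy 4-ball (the core of its 2-handle in the 1-handle-free homotopy sphere
`X_L ∪ 3-handles ∪ 4-handle`). -/
def rLink_component_isHomotopyBallSlice : Prop :=
  ∀ {n : ℕ} (L : FramedLink (Fin n)), IsRLink L → ∀ i, (L.component i).IsHomotopyBallSlice

/-- **Refill datum** (surrogate): the component `i` of the R-link `L` has a smoothly slice
0-friend — what a refill curve `γ` with `W ∪ h_γ ≅ B⁴` produces (the cocore knot). -/
def HasRefill {n : ℕ} (L : FramedLink (Fin n)) (i : Fin n) : Prop :=
  ∃ K : Knot, K.IsSmoothlySlice ∧ ZeroFriends K (L.component i)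

/-- The **transfer statement C⁺** of card 3. -/
def RLinkTransfer : Prop :=
  ∃ (n : ℕ) (L : FramedLink (Fin n)) (i : Fin n) (s : ℤ), IsRLink L ∧ HasRefill L i ∧
    (L.component i).HasRasmussenInvariant s ∧ s ≠ 0

theorem cruxBody_of_rLinkTransfer (h : RLinkTransfer) : CruxBody := by
  obtain ⟨n, L, i, s, -, ⟨K, hK, Y, _, _, h1, h2⟩, hs, hs0⟩ := h
  exact ⟨K, L.component i, Y, _, _, s, h1, h2, hK, hs, hs0⟩

end Summit.SmoothPoincare4.SmoothPoincare4.Cruxes.ZseCruxRasmussen.Sketch3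

end
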